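import Summits.QuantumFields.BalabanUV.Beta.SymCorrectorFace
import Summits.QuantumFields.BalabanUV.Beta.ChartConjugationReflection

/-!
# `BalabanUV.Beta.SymCorrectorSlot` — binder row D1, road «BF-x» junction (J1), the `Δ_n` Ward program (an2 R-D1-g43-3 (2)), brick TT3b = W-3′ (ii) (+ the (W-leg) half offered as
# O-g28-3) of the OWNER's `HOME/b2b-balaban-beta-d1-p2/J1-DEFECT-WORDS.md` v0.1: **THE LEG ACTIONS OF `Ψ̂_S` AND THE SLOT ADJUNCTION** —
#   §1 (W-leg) for ANY kernel `X`: `(Ψ̂_Sᵀ ∘ X)(x, w)_{inl β, b} = slotPsiS (κ u ↦ X(u, w)_{inl κ, b}) β x` (= `X + WᵀX`, the left field leg transported by the FACE SUM of TT3a), the multiplier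
#      legs untouched, and the mirror statements for `X ∘ Ψ̂_S` — so the OWNER's `HessKerConjugation.hessKer_conj_kernel` vertices `Ψ̂_Sᵀ∘V∘Ψ̂_S` are explicit finite face sums;
#   §4 (W-slot) **`vertexOfK (Ψ̂_S ∘ K ∘ Ψ̂_Sᵀ) n S μ y = vertexOfK K n (slotPsiS r n S) μ y`** for every spread `K`, every local stencil family `S`, every in-block root offset `r`
#      — the chain-rule vertex through the conjugated kernel is the vertex through `K` of the RAW table plus its block's signed, face-weighted FACE SUM of tables (`S + S^face`);
#      no infinite sum in the slot direction (the [S] sockets of the transported families are TT5 `SymCorrectorSockets`).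
# `Ψ̂_S = psiKS r n` (TT2a), chart of record `r = ctrOff (d+1) n`; with TT2b's END `GcombSh n 0 = Ψ̂_S ∘ G₀^{bm}(ctrOff) ∘ Ψ̂_Sᵀ` this is the (III′) literal's first-order vertex read on the road's kernel.
HOW ([folklore]).  §1: finite apply sums (TT3a).  §4 is ASSOCIATIVITY, not Fubini: `vertexOfK K n S μ y x z a b` is an entry of `Kᵀ ∘ colK T w₀ b₀` (§2, `T κ u := S κ u x z a b`); for
`K′ = Ψ̂∘K∘Ψ̂ᵀ`, `K′ᵀ = Ψ̂∘(Kᵀ∘Ψ̂ᵀ)`, `Ψ̂`'s multiplier row is the identity, an5's `comp_assoc_tame` moves `Ψ̂ᵀ` onto the column, and `Ψ̂ᵀ ∘ colK T = colK (slotPsiS T)`.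
HONEST FRAMING (cell contract, verbatim): «discharging `BetaPertH` makes Bałaban's UV stability UNCONDITIONAL — a real constructive-QFT result; it
is NOT the continuum limit and NOT the Clay problem.»  HONEST DEPENDENCY (verbatim): «continuum YM on T⁴ ⇐ BetaPertH ∧ nine spine estimates (0/9
proved); BetaPertH ⇐ (D1) ∧ (D4) ∧ CAP+tail; G-an2-4 gates asym, D1 and NE2/3/4.»
ABSOLUTE RULE (cell, verbatim): «No internally-minted statement may enter as a cited fact. Every hypothesis is either kernel-proved in this package or a
verbatim quotation of a PUBLISHED theorem with page reference. The manuscript(s) under audit are NOT citable for their own disputed steps — they are the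
thing under adjudication; programme-internal (2001/route/tribunal) claims are never citable.»  NOTHING is cited; one DATA definition ([our object] `colK`) and [folklore] finite-sum ∕
absolutely-convergent-sum bookkeeping over the cell's OWN typed objects BY NAME.  It prices NO row of (J1) ([S] shape only; [M] rows untouched); discharges NOTHING of (K), of
hW ∕ hR ∕ D1Tel ∕ D1Rep (0∕4), of D1 or of BetaPertH; NOT continuum, NOT Clay.

CONTENT ([folklore]; `d+1` the lattice dimension, `0 < n`, `r ∈ box (d+1) n`, `ρ = toSite r`):
§1 **`comp_trK_psiKS_inl_left`**, `comp_trK_psiKS_inr_left`, **`comp_psiKS_inl_right`**, `comp_psiKS_inr_right` (the leg actions, any `X`).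
§2 [our object] `colK T w₀ b₀`; `colK_apply_self ∕ colK_inr ∕ colK_of_ne`, `biLoc_colK`, `loc_colK`, `comp_trK_colK_apply`, **`comp_trK_psiKS_colK`** (`Ψ̂_Sᵀ ∘ colK T = colK (slotPsiS T)`).
§3 `abs_slotPsiS_le_of_bounded`, `abs_stencil_le_exp_left`.
§4 `vertexOfK_eq_comp_trK_colK`, `trK_conj`, **`vertexOfK_conj_psiKS_apply`** (entrywise, slot family localised at any centre — also the slices of a bi-stencil family),
   **`vertexOfK_conj_psiKS`** (THE SLOT ADJUNCTION for local stencil families), `vertexOfK_conj_psiKS_eq_add` (the OWNER's `V + V^face` shape).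
Provenance: D1 formalisation swarm, unit `b2b-balaban-beta-d1-formalise-leaf-03` (gen 29), 2026-08-23; over TT3a, TT2a, an5's `TameKernelCalculus`, an2's `tsum_point(')` BY NAME; no file touched.
-/

namespace Summit.QuantumFields.BalabanUV.Beta.SymCorrectorSlot

open Finset
open scoped BigOperators
open Literature.MathematicalPhysics.QuantumFieldTheory
open Literature.MathematicalPhysics.QuantumFieldTheory.Balaban1983to89
open Literature.MathematicalPhysics.QuantumFieldTheory.Balaban1983to89.Beta
open B12Sec2to5 (l1 l1_nonneg)
open ExpKernelCalculus (MKer Decays BiLoc comp l1_sub_triangle l1_sub_symm summable_exp_shift')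
open OneStepResolventKernel (Fib wsum LocStencil)
open OneStepKernelFamily (colH vertexOfK)
open AffineAveraging (Site Form1 box toSite unitVec)
open AveragingContours (blk)
open Summit.QuantumFields.BalabanUV.Beta.TameKernelCalculus (Spr Loc trK trK_apply trK_trK trK_comp comp_assoc_tame Spr.tame Loc.tame Spr.trK)
open Summit.QuantumFields.BalabanUV.Beta.ChartConjugationRelative (spr_comp)
open Summit.QuantumFields.BalabanUV.Beta.ChartConjugationReflection (vertexOfK_add)
open Summit.QuantumFields.BalabanUV.Beta.AxialDressingRooted (tsum_point tsum_point')
open Summit.QuantumFields.BalabanUV.Beta.KernelWardRelative (gaugeWt)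
open Summit.QuantumFields.BalabanUV.Beta.SymCorrectorForms (corrPsiS)
open Summit.QuantumFields.BalabanUV.Beta.SymCorrectorKernel (psiKS psiKS_inl_inl psiKS_inl_inr psiKS_inr_inl psiKS_inr_inr comp_psiKS_inr spr_psiKS)
open Summit.QuantumFields.BalabanUV.Beta.CompositeCorrectorKernel (indR)
open Summit.QuantumFields.BalabanUV.Beta.SymCorrectorFace (faceWt faceWtSum faceWtSum_nonneg abs_faceWt_le gaugeWt_eq bondNbhd card_bondNbhd_le l1_le_of_mem_bondNbhd
  faceSum slotPsiS slotPsiS_apply slotPsiS_zero slotPsiS_apply_kernel corrPsiS_indR_eq_zero_of_not_mem sum_tsum_corrPsiS_indR_mul)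

noncomputable section

variable {d : ℕ}

/-! ## §1 The leg actions of `Ψ̂_S` on an arbitrary kernel (W-leg) -/

section Legs

variable {n : ℕ} (hn : 0 < n) {r : Fin (d + 1) → ℕ} (hr : r ∈ box (d + 1) n)
include hn hr

/-- [folklore] **LEFT FIELD LEG: `(Ψ̂_Sᵀ ∘ X)(x, w)_{inl β, b} = slotPsiS (κ u ↦ X(u, w)_{inl κ, b}) β x`** — the left field leg of ANY kernel `X` is transported by the face sum
(`= X + WᵀX`: the raw leg plus `faceWt β x ·` the signed face sum of `X`'s left legs over `∂B(x)`); NO hypothesis on `X` (the middle sum is finite). -/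
theorem comp_trK_psiKS_inl_left (X : MKer (d + 1) (Fib d)) (x w : Site (d + 1)) (β : Fin (d + 1)) (b : Fib d) :
    comp (trK (psiKS r n)) X x w (Sum.inl β) b = slotPsiS r n (fun κ u => X u w (Sum.inl κ) b) β x := by
  classical
  unfold ExpKernelCalculus.comp
  have e : ∀ u, ∑ f : Fib d, trK (psiKS r n) x u (Sum.inl β) f * X u w f b = ∑ κ : Fin (d + 1), corrPsiS (toSite r) n (indR β x) κ u * X u w (Sum.inl κ) b := by
    intro u
    rw [Fintype.sum_sum_type]
    simp only [trK_apply, psiKS_inl_inl, psiKS_inr_inl, zero_mul, Finset.sum_const_zero, add_zero]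
  simp_rw [e]
  have hs : ∀ κ : Fin (d + 1), Summable fun u => corrPsiS (toSite r) n (indR β x) κ u * X u w (Sum.inl κ) b := fun κ =>
    summable_of_ne_finset_zero fun u hu => by rw [corrPsiS_indR_eq_zero_of_not_mem hn hr hu, zero_mul]
  rw [Summable.tsum_finsetSum (fun κ _ => hs κ)]
  exact sum_tsum_corrPsiS_indR_mul hn hr _ β x

omit hn hr in
/-- [folklore] **LEFT MULTIPLIER LEG UNTOUCHED**: `(Ψ̂_Sᵀ ∘ X)(x, w)_{inr m, b} = X(x, w)_{inr m, b}`. -/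
theorem comp_trK_psiKS_inr_left (X : MKer (d + 1) (Fib d)) (x w : Site (d + 1)) (m : Fin (d + 1)) (b : Fib d) :
    comp (trK (psiKS r n)) X x w (Sum.inr m) b = X x w (Sum.inr m) b := by
  unfold ExpKernelCalculus.comp
  have e : ∀ u, ∑ f : Fib d, trK (psiKS r n) x u (Sum.inr m) f * X u w f b = if x = u then X u w (Sum.inr m) b else 0 := by
    intro u
    rw [Fintype.sum_sum_type]
    simp only [trK_apply, psiKS_inl_inr, zero_mul, Finset.sum_const_zero, zero_add, psiKS_inr_inr]
    rw [Finset.sum_eq_single m (fun m' _ hm' => by rw [if_neg (fun h => hm' h.2), zero_mul]) (fun h => absurd (Finset.mem_univ m) h)]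
    by_cases hu : x = u
    · rw [if_pos ⟨hu.symm, rfl⟩, one_mul, if_pos hu]
    · rw [if_neg (fun h => hu h.1.symm), zero_mul, if_neg hu]
  simp_rw [e]
  exact tsum_point x _

/-- [folklore] **RIGHT FIELD LEG: `(X ∘ Ψ̂_S)(x, w)_{a, inl β} = slotPsiS (κ u ↦ X(x, u)_{a, inl κ}) β w`** (`= X + XW`); NO hypothesis on `X`. -/
theorem comp_psiKS_inl_right (X : MKer (d + 1) (Fib d)) (x w : Site (d + 1)) (a : Fib d) (β : Fin (d + 1)) :
    comp X (psiKS r n) x w a (Sum.inl β) = slotPsiS r n (fun κ u => X x u a (Sum.inl κ)) β w := by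
  classical
  unfold ExpKernelCalculus.comp
  have e : ∀ u, ∑ f : Fib d, X x u a f * psiKS r n u w f (Sum.inl β) = ∑ κ : Fin (d + 1), corrPsiS (toSite r) n (indR β w) κ u * X x u a (Sum.inl κ) := by
    intro u
    rw [Fintype.sum_sum_type]
    simp only [psiKS_inl_inl, psiKS_inr_inl, mul_zero, Finset.sum_const_zero, add_zero]
    exact Finset.sum_congr rfl fun κ _ => mul_comm _ _
  simp_rw [e]
  have hs : ∀ κ : Fin (d + 1), Summable fun u => corrPsiS (toSite r) n (indR β w) κ u * X x u a (Sum.inl κ) := fun κ =>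
    summable_of_ne_finset_zero fun u hu => by rw [corrPsiS_indR_eq_zero_of_not_mem hn hr hu, zero_mul]
  rw [Summable.tsum_finsetSum (fun κ _ => hs κ)]
  exact sum_tsum_corrPsiS_indR_mul hn hr _ β w

omit hn hr in
/-- [folklore] **RIGHT MULTIPLIER LEG UNTOUCHED**: `(X ∘ Ψ̂_S)(x, w)_{a, inr m} = X(x, w)_{a, inr m}`. -/
theorem comp_psiKS_inr_right (X : MKer (d + 1) (Fib d)) (x w : Site (d + 1)) (a : Fib d) (m : Fin (d + 1)) :
    comp X (psiKS r n) x w a (Sum.inr m) = X x w a (Sum.inr m) := by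
  unfold ExpKernelCalculus.comp
  have e : ∀ u, ∑ f : Fib d, X x u a f * psiKS r n u w f (Sum.inr m) = if u = w then X x u a (Sum.inr m) else 0 := by
    intro u
    rw [Fintype.sum_sum_type]
    simp only [psiKS_inl_inr, mul_zero, Finset.sum_const_zero, zero_add, psiKS_inr_inr]
    rw [Finset.sum_eq_single m (fun m' _ hm' => by rw [if_neg (fun h => hm' h.2), mul_zero]) (fun h => absurd (Finset.mem_univ m) h)]
    by_cases hu : u = w
    · rw [if_pos ⟨hu, rfl⟩, mul_one, if_pos hu]
    · rw [if_neg (fun h => hu h.1), mul_zero, if_neg hu]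
  simp_rw [e]
  rw [tsum_point' w (fun u => X x u a (Sum.inr m))]

end Legs

/-! ## §2 The column kernel of a scalar bond family and the action of `Ψ̂_Sᵀ` on it -/

/-- [our object] **THE COLUMN KERNEL** of the scalar bond family `T`: the `(w₀, b₀)`-column with field rows `T κ u` and vanishing multiplier rows (every other column `0`). -/
def colK (T : Form1 (d + 1) ℝ) (w₀ : Site (d + 1)) (b₀ : Fib d) : MKer (d + 1) (Fib d) :=
  fun u w f b => if w = w₀ ∧ b = b₀ then Sum.elim (fun κ => T κ u) (fun _ => (0 : ℝ)) f else 0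

section ColK

variable (T : Form1 (d + 1) ℝ) (w₀ : Site (d + 1)) (b₀ : Fib d)

/-- [folklore] Field rows of the column. -/
theorem colK_apply_self (u : Site (d + 1)) (κ : Fin (d + 1)) : colK T w₀ b₀ u w₀ (Sum.inl κ) b₀ = T κ u := by
  simp [colK]

/-- [folklore] Multiplier rows vanish. -/
theorem colK_inr (u w : Site (d + 1)) (m : Fin (d + 1)) (b : Fib d) : colK T w₀ b₀ u w (Sum.inr m) b = 0 := by
  unfold colK; split_ifs <;> rfl

/-- [folklore] Every other column vanishes. -/
theorem colK_of_ne {u w : Site (d + 1)} {f b : Fib d} (h : ¬(w = w₀ ∧ b = b₀)) : colK T w₀ b₀ u w f b = 0 := if_neg h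

variable {T}

/-- [folklore] **A LOCALISED BOND FAMILY GIVES A BI-LOCALISED COLUMN**: `|T κ u| ≤ C·e^{−δ|u−p|₁} ⟹ BiLoc (colK T w₀ b₀) p w₀ C δ`. -/
theorem biLoc_colK {p : Site (d + 1)} {C δ : ℝ} (hC : 0 ≤ C) (hT : ∀ κ u, |T κ u| ≤ C * Real.exp (-δ * l1 (u - p))) :
    BiLoc (colK T w₀ b₀) p w₀ C δ := by
  intro u w f b
  by_cases h : w = w₀ ∧ b = b₀
  · obtain ⟨rfl, rfl⟩ := h
    have hl : l1 (w - w) = 0 := by simp [l1]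
    rw [hl, add_zero]
    rcases f with κ | m
    · rw [colK_apply_self]; exact hT κ u
    · rw [colK_inr, abs_zero]; positivity
  · rw [colK_of_ne _ _ _ h, abs_zero]; positivity

/-- [folklore] Hence `Loc (colK T w₀ b₀)` for a localised family (`0 < δ`). -/
theorem loc_colK {p : Site (d + 1)} {C δ : ℝ} (hC : 0 ≤ C) (hδ : 0 < δ) (hT : ∀ κ u, |T κ u| ≤ C * Real.exp (-δ * l1 (u - p))) :
    Loc (colK T w₀ b₀) :=
  ⟨p, w₀, C, δ, hδ, biLoc_colK w₀ b₀ hC hT⟩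

variable (T)

/-- [folklore] **THE `(v, w₀)` ENTRY OF `Kᵀ ∘ colK T`** is `Σ_κ Σ'_u K u v (inl κ) a · T κ u` (summable slices). -/
theorem comp_trK_colK_apply (K : MKer (d + 1) (Fib d)) (v : Site (d + 1)) (a : Fib d) (hs : ∀ κ : Fin (d + 1), Summable fun u => K u v (Sum.inl κ) a * T κ u) :
    comp (trK K) (colK T w₀ b₀) v w₀ a b₀ = ∑ κ : Fin (d + 1), ∑' u, K u v (Sum.inl κ) a * T κ u := by
  unfold ExpKernelCalculus.comp
  have e : ∀ u, ∑ f : Fib d, trK K v u a f * colK T w₀ b₀ u w₀ f b₀ = ∑ κ : Fin (d + 1), K u v (Sum.inl κ) a * T κ u := by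
    intro u
    rw [Fintype.sum_sum_type]
    simp only [trK_apply, colK_apply_self, colK_inr, mul_zero, Finset.sum_const_zero, add_zero]
  simp_rw [e]
  exact Summable.tsum_finsetSum fun κ _ => hs κ

end ColK

section PsiCol

variable {n : ℕ} (hn : 0 < n) {r : Fin (d + 1) → ℕ} (hr : r ∈ box (d + 1) n)
include hn hr

/-- [folklore] **`Ψ̂_Sᵀ` ACTS ON A COLUMN KERNEL BY THE SLOT TRANSPORT**: `comp (trK (psiKS r n)) (colK T w₀ b₀) = colK (slotPsiS r n T) w₀ b₀` — NO hypothesis on `T` (§1 on `X := colK T w₀ b₀`). -/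
theorem comp_trK_psiKS_colK (T : Form1 (d + 1) ℝ) (w₀ : Site (d + 1)) (b₀ : Fib d) :
    comp (trK (psiKS r n)) (colK T w₀ b₀) = colK (slotPsiS r n T) w₀ b₀ := by
  classical
  funext x w a b
  rcases a with β | m
  · rw [comp_trK_psiKS_inl_left hn hr]
    by_cases h : w = w₀ ∧ b = b₀
    · obtain ⟨rfl, rfl⟩ := h
      have e : (fun κ u => colK T w b u w (Sum.inl κ) b) = T := by funext κ u; exact colK_apply_self T w b u κ
      rw [e, colK_apply_self]
    · have e : (fun κ u => colK T w₀ b₀ u w (Sum.inl κ) b) = 0 := by funext κ u; exact colK_of_ne T w₀ b₀ h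
      rw [e, slotPsiS_zero, colK_of_ne _ w₀ b₀ h]; rfl
  · rw [comp_trK_psiKS_inr_left, colK_inr, colK_inr]

end PsiCol

/-! ## §3 The transported family of a bounded family is bounded; a local stencil family read at an entry is localised at the left site -/

section Stencil

/-- [folklore] **BOUNDED SCALAR FAMILIES TRANSPORT TO BOUNDED FAMILIES**: `|T κ u| ≤ B ⟹ |slotPsiS r n T α x| ≤ B·(1 + faceWtSum·(d+1)·2n^{d+1})` (`|gaugeWt| ≤ 1`, `|faceWt| ≤ faceWtSum`). -/
theorem abs_slotPsiS_le_of_bounded {n : ℕ} (hn : 0 < n) (r : Fin (d + 1) → ℕ) {T : Form1 (d + 1) ℝ} {B : ℝ} (hB : ∀ κ u, |T κ u| ≤ B)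
    (α : Fin (d + 1)) (x : Site (d + 1)) :
    |slotPsiS r n T α x| ≤ B * (1 + faceWtSum r n * (((d + 1 : ℕ) : ℝ) * (2 * (n : ℝ) ^ (d + 1)))) := by
  classical
  have hB0 : 0 ≤ B := (abs_nonneg _).trans (hB α x)
  have hin : ∀ κ' : Fin (d + 1), |∑ u ∈ bondNbhd n (blk n x) κ', gaugeWt n (blk n x) κ' u * T κ' u| ≤ (2 * (n : ℝ) ^ (d + 1)) * B := by
    intro κ'
    refine (Finset.abs_sum_le_sum_abs _ _).trans ?_
    calc ∑ u ∈ bondNbhd n (blk n x) κ', |gaugeWt n (blk n x) κ' u * T κ' u| ≤ ∑ _u ∈ bondNbhd n (blk n x) κ', B :=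
          Finset.sum_le_sum fun u _ => by
            rw [abs_mul]
            have hg : |gaugeWt n (blk n x) κ' u| ≤ 1 := by rw [gaugeWt_eq]; split_ifs <;> norm_num
            calc |gaugeWt n (blk n x) κ' u| * |T κ' u| ≤ 1 * B := mul_le_mul hg (hB κ' u) (abs_nonneg _) zero_le_one
              _ = B := one_mul _
      _ = (bondNbhd n (blk n x) κ').card * B := by rw [Finset.sum_const, nsmul_eq_mul]
      _ ≤ (2 * (n : ℝ) ^ (d + 1)) * B := mul_le_mul_of_nonneg_right (card_bondNbhd_le n _ κ') hB0
  have hface : |∑ κ' : Fin (d + 1), ∑ u ∈ bondNbhd n (blk n x) κ', gaugeWt n (blk n x) κ' u * T κ' u| ≤ ((d + 1 : ℕ) : ℝ) * (2 * (n : ℝ) ^ (d + 1)) * B := by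
    refine (Finset.abs_sum_le_sum_abs _ _).trans ?_
    calc ∑ κ' : Fin (d + 1), |∑ u ∈ bondNbhd n (blk n x) κ', gaugeWt n (blk n x) κ' u * T κ' u| ≤ ∑ _κ' : Fin (d + 1), (2 * (n : ℝ) ^ (d + 1)) * B :=
          Finset.sum_le_sum fun κ' _ => hin κ'
      _ = ((d + 1 : ℕ) : ℝ) * (2 * (n : ℝ) ^ (d + 1)) * B := by rw [Finset.sum_const, Finset.card_univ, Fintype.card_fin, nsmul_eq_mul]; ring
  rw [slotPsiS_apply]
  simp only [smul_eq_mul]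
  refine (abs_add_le _ _).trans ?_
  rw [abs_mul]
  calc |T α x| + |faceWt r n α x| * |∑ κ' : Fin (d + 1), ∑ u ∈ bondNbhd n (blk n x) κ', gaugeWt n (blk n x) κ' u * T κ' u|
      ≤ B + faceWtSum r n * (((d + 1 : ℕ) : ℝ) * (2 * (n : ℝ) ^ (d + 1)) * B) :=
        add_le_add (hB α x) (mul_le_mul (abs_faceWt_le hn r α x) hface (abs_nonneg _) (faceWtSum_nonneg r n))
    _ = B * (1 + faceWtSum r n * (((d + 1 : ℕ) : ℝ) * (2 * (n : ℝ) ^ (d + 1)))) := by ring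

variable {S : Fin (d + 1) → Site (d + 1) → MKer (d + 1) (Fib d)} {Cs δs : ℝ}

/-- [folklore] **A LOCAL STENCIL FAMILY, READ AT A FIXED ENTRY, IS LOCALISED IN THE SLOT INDEX AT THE LEFT SITE**: `|S κ u x z a b| ≤ Cs·e^{−δ|u − x|₁}` (drop the second leg). -/
theorem abs_stencil_le_exp_left (hS : LocStencil S Cs δs) (hδs : 0 ≤ δs) (κ : Fin (d + 1)) (u x z : Site (d + 1)) (a b : Fib d) :
    |S κ u x z a b| ≤ Cs * Real.exp (-δs * l1 (u - x)) := by
  have hCs : 0 ≤ Cs := (hS κ u).nonneg (Sum.inl 0)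
  refine (hS κ u x z a b).trans (mul_le_mul_of_nonneg_left (Real.exp_le_exp.2 ?_) hCs)
  rw [l1_sub_symm u x]
  nlinarith [l1_nonneg (z - u)]

end Stencil

/-! ## §4 The slot adjunction -/

section Adjunction

/-- [folklore] **THE CHAIN-RULE VERTEX IS AN ENTRY OF `Kᵀ ∘ colK`**: `vertexOfK K n S μ y x z a b = (Kᵀ ∘ colK (κ u ↦ S κ u x z a b) w₀ b₀)((n•y, inr μ), (w₀, b₀))` — decaying `K`, and `S` BOUNDED at the
entry `(x, z, a, b)` (all that the absolute convergence of the slot series needs). -/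
theorem vertexOfK_eq_comp_trK_colK {n : ℕ} {K : MKer (d + 1) (Fib d)} {C δ : ℝ} (hK : Decays K C δ) (hδ : 0 < δ)
    {S : Fin (d + 1) → Site (d + 1) → MKer (d + 1) (Fib d)} (x z : Site (d + 1)) (a b : Fib d) {B : ℝ} (hB : ∀ κ u, |S κ u x z a b| ≤ B)
    (μ : Fin (d + 1)) (y w₀ : Site (d + 1)) (b₀ : Fib d) :
    vertexOfK K n S μ y x z a b = comp (trK K) (colK (fun κ u => S κ u x z a b) w₀ b₀) ((n : ℤ) • y) w₀ (Sum.inr μ) b₀ := by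
  have hC : 0 ≤ C := hK.nonneg (Sum.inl 0)
  have hs : ∀ κ : Fin (d + 1), Summable fun u => K u ((n : ℤ) • y) (Sum.inl κ) (Sum.inr μ) * S κ u x z a b := fun κ =>
    Summable.of_norm_bounded (((summable_exp_shift' hδ ((n : ℤ) • y)).mul_left C).mul_right B) fun u => by
      rw [Real.norm_eq_abs, abs_mul]
      exact mul_le_mul (hK _ _ _ _) (hB κ u) (abs_nonneg _) (by positivity)
  rw [comp_trK_colK_apply _ w₀ b₀ K _ _ hs]
  rfl

/-- [folklore] Transpose of a conjugate: `(P ∘ K ∘ Pᵀ)ᵀ = P ∘ (Kᵀ ∘ Pᵀ)`. -/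
theorem trK_conj (P K : MKer (d + 1) (Fib d)) : trK (comp (comp P K) (trK P)) = comp P (comp (trK K) (trK P)) := by
  rw [trK_comp, trK_comp, trK_trK]

/-- [folklore] **THE SLOT ADJUNCTION AT `Ψ̂_S`, ENTRYWISE** — the sharp hypothesis: at the entry `(x, z, a, b)` the slot family `κ u ↦ S κ u x z a b` is LOCALISED SOMEWHERE
(`|S κ u x z a b| ≤ C·e^{−δ|u − p|₁}`, any centre `p`, `0 < δ`; covers local stencil families (centre `x`) AND the slices `S₂ κ u` of a fine bi-stencil family (centre `u`) for the pair slot):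
`vertexOfK (Ψ̂_S ∘ K ∘ Ψ̂_Sᵀ) n S μ y x z a b = vertexOfK K n (slotPsiS r n S) μ y x z a b`.  ASSOCIATIVITY (`comp_assoc_tame` ×2 with `Loc (colK T)`), `comp_psiKS_inr`, `comp_trK_psiKS_colK`. -/
theorem vertexOfK_conj_psiKS_apply {n : ℕ} (hn : 0 < n) {r : Fin (d + 1) → ℕ} (hr : r ∈ box (d + 1) n) {K : MKer (d + 1) (Fib d)} (hK : Spr K)
    (S : Fin (d + 1) → Site (d + 1) → MKer (d + 1) (Fib d)) (μ : Fin (d + 1)) (y x z : Site (d + 1)) (a b : Fib d)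
    {p : Site (d + 1)} {C δ : ℝ} (hδ : 0 < δ) (hT : ∀ κ u, |S κ u x z a b| ≤ C * Real.exp (-δ * l1 (u - p))) :
    vertexOfK (comp (comp (psiKS r n) K) (trK (psiKS r n))) n S μ y x z a b = vertexOfK K n (slotPsiS r n S) μ y x z a b := by
  have hΨ : Spr (psiKS r n) := spr_psiKS hn hr
  have hK2 := hK
  obtain ⟨CK, δK, hδK, hKd⟩ := hK2
  have hK' : Spr (comp (comp (psiKS r n) K) (trK (psiKS r n))) := spr_comp (spr_comp hΨ hK) hΨ.trK
  obtain ⟨C', δ', hδ', hK'd⟩ := hK'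
  have hC : 0 ≤ C := by
    have h := hT μ p
    rw [sub_self, show l1 (0 : Site (d + 1)) = 0 by simp [l1], mul_zero, Real.exp_zero, mul_one] at h
    exact (abs_nonneg _).trans h
  -- the scalar family at this entry: bounded by `C`, localised at `p`; its transport bounded
  have hB : ∀ κ u, |(fun κ u => S κ u x z a b) κ u| ≤ C := fun κ u =>
    (hT κ u).trans (by
      have : Real.exp (-δ * l1 (u - p)) ≤ 1 := by rw [Real.exp_le_one_iff]; nlinarith [l1_nonneg (u - p)]
      nlinarith)
  have hB' : ∀ κ u, |slotPsiS r n S κ u x z a b| ≤ C * (1 + faceWtSum r n * (((d + 1 : ℕ) : ℝ) * (2 * (n : ℝ) ^ (d + 1)))) := by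
    intro κ u
    rw [slotPsiS_apply_kernel]
    exact abs_slotPsiS_le_of_bounded hn r hB κ u
  have hcol : Loc (colK (fun κ u => S κ u x z a b) z b) := loc_colK z b hC hδ hT
  rw [vertexOfK_eq_comp_trK_colK hK'd hδ' x z a b hB μ y z b, vertexOfK_eq_comp_trK_colK hKd hδK x z a b hB' μ y z b]
  have eT : (fun κ u => slotPsiS r n S κ u x z a b) = slotPsiS r n (fun κ u => S κ u x z a b) := by
    funext κ u; exact slotPsiS_apply_kernel r n S κ u x z a b
  rw [eT, ← comp_trK_psiKS_colK hn hr, trK_conj, ← comp_assoc_tame hΨ.tame (spr_comp hK.trK hΨ.trK).tame hcol.tame, comp_psiKS_inr,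
    ← comp_assoc_tame hK.trK.tame hΨ.trK.tame hcol.tame]

/-- [folklore] **THE SLOT ADJUNCTION AT `Ψ̂_S`** (W-3′ (ii) of the road's `J1-DEFECT-WORDS.md` v0.1): for every spread `K`, every local stencil family `S` (`0 < δ`) and every in-block root offset,
`vertexOfK (Ψ̂_S ∘ K ∘ Ψ̂_Sᵀ) n S μ y = vertexOfK K n (slotPsiS r n S) μ y` — the chain-rule vertex through the conjugated kernel is the vertex through `K` of the slot-transported family
`S + S^face` (the raw table plus its block's signed, face-weighted face sum of tables; no infinite sum in the slot direction). -/
theorem vertexOfK_conj_psiKS {n : ℕ} (hn : 0 < n) {r : Fin (d + 1) → ℕ} (hr : r ∈ box (d + 1) n) {K : MKer (d + 1) (Fib d)} (hK : Spr K)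
    {S : Fin (d + 1) → Site (d + 1) → MKer (d + 1) (Fib d)} {Cs δs : ℝ} (hS : LocStencil S Cs δs) (hδs : 0 < δs) (μ : Fin (d + 1)) (y : Site (d + 1)) :
    vertexOfK (comp (comp (psiKS r n) K) (trK (psiKS r n))) n S μ y = vertexOfK K n (slotPsiS r n S) μ y := by
  funext x z a b
  exact vertexOfK_conj_psiKS_apply hn hr hK S μ y x z a b hδs (fun κ u => abs_stencil_le_exp_left hS hδs.le κ u x z a b)

/-- [folklore] **W-3′ IN THE ROAD OWNER's SHAPE** (OWNER-MEMO-g22 v3 §3″.1): `vertexOfK (Ψ̂_S ∘ K ∘ Ψ̂_Sᵀ) n S μ y = vertexOfK K n S μ y + vertexOfK K n S^face μ y`,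
`S^face α x := faceWt r n α x • faceSum n S (blk n x)` — the socket `V + Vᵈ` of the OWNER's `HessKerConjugation.hessKer_add_add_sub` (additivity: an5∕an2's `vertexOfK_add`). -/
theorem vertexOfK_conj_psiKS_eq_add {n : ℕ} (hn : 0 < n) {r : Fin (d + 1) → ℕ} (hr : r ∈ box (d + 1) n) {K : MKer (d + 1) (Fib d)} (hK : Spr K)
    {S : Fin (d + 1) → Site (d + 1) → MKer (d + 1) (Fib d)} {Cs δs : ℝ} (hS : LocStencil S Cs δs) (hδs : 0 < δs) (μ : Fin (d + 1)) (y : Site (d + 1)) :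
    vertexOfK (comp (comp (psiKS r n) K) (trK (psiKS r n))) n S μ y
      = vertexOfK K n S μ y + vertexOfK K n (fun α x => faceWt r n α x • faceSum n S (blk n x)) μ y := by
  have hK2 := hK
  obtain ⟨C, δ, hδ, hKd⟩ := hK2
  have hCs : 0 ≤ Cs := (hS μ y).nonneg (Sum.inl 0)
  set B : ℝ := Cs * (1 + faceWtSum r n * (((d + 1 : ℕ) : ℝ) * (2 * (n : ℝ) ^ (d + 1)))) + Cs with hB
  have hSb : ∀ κ u x z a b, |S κ u x z a b| ≤ Cs := fun κ u x z a b =>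
    (abs_stencil_le_exp_left hS hδs.le κ u x z a b).trans (by
      have : Real.exp (-δs * l1 (u - x)) ≤ 1 := by rw [Real.exp_le_one_iff]; nlinarith [l1_nonneg (u - x)]
      nlinarith)
  have h1 : ∀ κ u x z a b, |S κ u x z a b| ≤ B := fun κ u x z a b => (hSb κ u x z a b).trans (by
    have : 0 ≤ Cs * (1 + faceWtSum r n * (((d + 1 : ℕ) : ℝ) * (2 * (n : ℝ) ^ (d + 1)))) := by have := faceWtSum_nonneg r n; positivity
    linarith)
  have h2 : ∀ κ u x z a b, |(fun α x => faceWt r n α x • faceSum n S (blk n x)) κ u x z a b| ≤ B := by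
    intro κ u x z a b
    have e : (fun α x => faceWt r n α x • faceSum n S (blk n x)) κ u x z a b = slotPsiS r n (fun κ' u' => S κ' u' x z a b) κ u - S κ u x z a b := by
      rw [← slotPsiS_apply_kernel, slotPsiS]; simp only [Pi.add_apply, Pi.smul_apply, add_sub_cancel_left]
    rw [e]
    refine (abs_sub _ _).trans (add_le_add (abs_slotPsiS_le_of_bounded hn r (fun κ' u' => hSb κ' u' x z a b) κ u) (hSb κ u x z a b))
  rw [vertexOfK_conj_psiKS hn hr hK hS hδs]
  exact vertexOfK_add ⟨δ, C, hδ, hKd.nonneg (Sum.inl 0), hKd⟩ h1 h2 μ y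

end Adjunction

end

end Summit.QuantumFields.BalabanUV.Beta.SymCorrectorSlot
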